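import Literature.MathematicalPhysics.QuantumFieldTheory.Balaban1983to89.Beta.GhostTable

/-!
# `D1BFx.GhostContactExp` — THE CONTACT VERTEX OF THE TWO-JET (EXPONENTIAL) BOND TRANSPORTER IS THE
REVERSAL-SYMMETRIC CROSS CONTACT `½·(E_{x+e,x} + E_{x,x+e}) ⊗ (AᵀA)`; the head contact `E_{x+e,x+e} ⊗ (AᵀA)` of the one-jet model CANCELS

HONEST DEPENDENCY (cell `pub-balaban`, β sub-cell): continuum YM on T⁴ ⇐ BetaPertH ∧ nine spine estimates (0/9 proved); BetaPertH ⇐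
(D1) ∧ (D4) ∧ CAP+tail; G-an2-4 gates asym, D1 and NE2/3/4.  HONEST FRAMING: discharging BetaPertH makes Bałaban's UV stability
UNCONDITIONAL — NOT the continuum limit and NOT the Clay problem.  This module is far less: three lines of `[folklore]` matrix algebra over
the Literature module `Beta.GhostTable`'s own objects (D1 road BF-x, typer addendum to row T6; under `Summits/` because it is OUR bookkeeping,
not a printed statement); 0 definitions, 0 `Prop`s, 0 citations used, 0 binders of anything discharged.

WHAT.  `GhostTable` §1 models the bond transporter by its FIRST JET `1 + tA` and finds the `t²`-coefficient of the bond Laplacian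
`K(t) = D(t)ᵀD(t) + R` to be the HEAD CONTACT `vertex₂ x e A = E_{x+e,x+e} ⊗ (AᵀA)` (`vertex₂_eq`); its §6 (`lapFamilyJ_expand`) records that with
an arbitrary SECOND JET `B` (`1 + tA + t²B`) the `t²`-coefficient becomes `vertex₂ x e A + vertex₁ x e B` («higher jets change the contact only»).
Here the one case that matters is evaluated: the EXPONENTIAL transporter `exp(tA) = 1 + tA + t²·A²/2 + …` of a SKEW generator `Aᵀ = −A` (the
adjoint action of a Lie-algebra element for the invariant form — `GhostTable`'s own modelling sentence, [Balaban1987RG1] p. 258 «U_k = exp iηH»,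
CONTEXT ONLY).  Then (`contact_exp_eq_cross`)

  `vertex₂ x e A + vertex₁ x e (½·A²) = ½ · (E_{x+e,x} ⊗ (AᵀA) + E_{x,x+e} ⊗ (AᵀA))`:

the head entry cancels EXACTLY (`AᵀA = −A²` against the two head entries `E_{x+e,x+e} ⊗ (B + Bᵀ)`, `B = Bᵀ = A²/2`) and what remains is the
CROSS contact between the two ends of the bond, symmetric under bond reversal, with HALF the head contact's colour weight.  Equivalently
(orthogonality): `(exp tA)ᵀ(exp tA) = 1` for skew `A`, so `|exp(tA)f(x+e) − f(x)|²` has no `t`-dependent head term at any order.  The same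
cancellation is implicit in an2's `BackgroundVertices.K₂form` (the `B(V₁g)(V₁f)` term against the `½·B(ad(A)²g(sx))(f(sx))` terms for an
invariant pairing); it is made explicit here in the `elemIns` currency that the D1 road's stripped tables use.

WHY (bookkeeping note, NOT a claim about Bałaban's text).  On the D1 road (`Summits/…/Beta/D1BFx/`) the typer's T6 v1 `GhostStencil.ghCnt`∕`Wgh`
transcribed `vertex₂_eq` — the ONE-JET model's head contact; leaf-01-g3's kernel no-gos (`GhostStencilReflection(Q)`, `GhostStencilWard`:
the head contact fails both the parity and the (W2) Ward socket, the reversal-symmetric `ghX` passes both with the current's weight) asked which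
contact the exact transporter carries (owner question CHECK-N0).  This file answers the MODEL-side half by computation: for `GhostTable`'s bond
Laplacian with the two-jet exponential transporter of a skew generator, the contact is the cross contact `½·ghX`-shape.  Whether Bałaban's
`Δ_U` of [Balaban1985BackgroundPropagators] (3.121)–(3.122) IS this bond Laplacian remains `GhostTable`'s header identification (CONTEXT ONLY
there and here); nothing printed is asserted.

Tags: [folklore] = elementary algebra proved here.  No `axiom`, no `sorry`, no `def`.
-/

namespace Summit.QuantumFields.BalabanUV.Beta.D1BFx.GhostContactExp

open scoped Matrix
open Literature.MathematicalPhysics.QuantumFieldTheory.Balaban1983to89.Beta.BubbleTable (elemIns)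
open Literature.MathematicalPhysics.QuantumFieldTheory.Balaban1983to89.Beta.GhostTable

variable {Λ : Type*} [Fintype Λ] [DecidableEq Λ] [AddCommGroup Λ] {C : Type*} [Fintype C] [DecidableEq C]

omit [DecidableEq C] in
/-- [folklore] For a skew generator the one-jet contact weight is minus the square: `AᵀA = −A²`. -/
theorem transpose_mul_self_of_skew {A : Matrix C C ℝ} (hA : Aᵀ = -A) : Aᵀ * A = -(A * A) := by
  rw [hA, Matrix.neg_mul]

omit [DecidableEq C] in
/-- [folklore] The second jet `A²/2` of `exp(tA)` is symmetric when `A` is skew. -/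
theorem transpose_half_sq_of_skew {A : Matrix C C ℝ} (hA : Aᵀ = -A) : ((1 / 2 : ℝ) • (A * A))ᵀ = (1 / 2 : ℝ) • (A * A) := by
  rw [Matrix.transpose_smul, Matrix.transpose_mul, hA, neg_mul_neg]

/-- [folklore] The first-order vertex AT THE SECOND JET `A²/2` of a skew generator: a full head entry minus half a cross contact,
`vertex₁ x e (A²/2) = E_{x+e,x+e} ⊗ A² − ½·(E_{x,x+e} ⊗ A² + E_{x+e,x} ⊗ A²)`. -/
theorem vertex₁_half_sq {A : Matrix C C ℝ} (hA : Aᵀ = -A) (x e : Λ) :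
    vertex₁ x e ((1 / 2 : ℝ) • (A * A)) =
      elemIns (x + e) (x + e) (A * A) - (1 / 2 : ℝ) • (elemIns x (x + e) (A * A) + elemIns (x + e) x (A * A)) := by
  rw [vertex₁_eq, transpose_half_sq_of_skew hA, elemIns_smul, elemIns_smul, elemIns_smul]
  module

/-- [folklore] **THE EXPONENTIAL TRANSPORTER'S CONTACT IS THE CROSS CONTACT.**  For a skew generator `Aᵀ = −A`, the `t²`-coefficient
`vertex₂ x e A + vertex₁ x e (A²/2)` of `GhostTable.lapFamilyJ x e A (A²/2) R` (`lapFamilyJ_expand`) equals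
`½·(E_{x+e,x} ⊗ (AᵀA) + E_{x,x+e} ⊗ (AᵀA))` — NO head entry; half the one-jet head weight on each of the two cross entries. -/
theorem contact_exp_eq_cross {A : Matrix C C ℝ} (hA : Aᵀ = -A) (x e : Λ) :
    vertex₂ x e A + vertex₁ x e ((1 / 2 : ℝ) • (A * A)) =
      (1 / 2 : ℝ) • (elemIns (x + e) x (Aᵀ * A) + elemIns x (x + e) (Aᵀ * A)) := by
  rw [vertex₂_eq, vertex₁_half_sq hA, transpose_mul_self_of_skew hA, elemIns_neg, elemIns_neg, elemIns_neg]
  module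

/-- [folklore] **THE TWO-JET BOND LAPLACIAN OF A SKEW GENERATOR, EXPANDED**: `K(t) = K(0) + t·current + t²·½·(E_{x+e,x} + E_{x,x+e}) ⊗ (AᵀA)
+ t³·jetCross + t⁴·vertex₂(A²/2)` — the linear coefficient is the antisymmetric CURRENT (`vertex₁_eq_current`), the quadratic one the CROSS
CONTACT (`contact_exp_eq_cross`); the `t³`, `t⁴` terms are beyond second order in the background. -/
theorem lapFamilyJ_exp_expand {A : Matrix C C ℝ} (hA : Aᵀ = -A) (x e : Λ) (R : Matrix (Λ × C) (Λ × C) ℝ) (t : ℝ) :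
    lapFamilyJ x e A ((1 / 2 : ℝ) • (A * A)) R t =
      lapFamilyJ x e A ((1 / 2 : ℝ) • (A * A)) R 0 + t • current x e A +
        t ^ 2 • ((1 / 2 : ℝ) • (elemIns (x + e) x (Aᵀ * A) + elemIns x (x + e) (Aᵀ * A))) +
        t ^ 3 • jetCross x e A ((1 / 2 : ℝ) • (A * A)) + t ^ 4 • vertex₂ x e ((1 / 2 : ℝ) • (A * A)) := by
  rw [lapFamilyJ_expand, ← contact_exp_eq_cross hA, vertex₁_eq_current x e hA]

/-- [folklore] **NO HEAD CONTACT**: the `(x+e, x+e)` colour block of the exponential transporter's `t²`-coefficient VANISHES whenever `e ≠ 0`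
(read off `contact_exp_eq_cross`: both cross insertions are off the head diagonal). -/
theorem contact_exp_head_entry {A : Matrix C C ℝ} (hA : Aᵀ = -A) (x e : Λ) (he : e ≠ 0) (c c' : C) :
    (vertex₂ x e A + vertex₁ x e ((1 / 2 : ℝ) • (A * A))) (x + e, c) (x + e, c') = 0 := by
  have hx : x + e ≠ x := fun h => he (add_left_cancel (a := x) (by rw [add_zero]; exact h))
  rw [contact_exp_eq_cross hA]
  simp only [Matrix.smul_apply, Matrix.add_apply, elemIns, Matrix.of_apply, hx, and_false, false_and, if_false, add_zero, smul_zero]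

/-- [folklore] **THE CROSS ENTRIES**: the `(x+e, x)` and `(x, x+e)` colour blocks of the `t²`-coefficient are `½·(AᵀA)` each (`e ≠ 0`). -/
theorem contact_exp_cross_entry {A : Matrix C C ℝ} (hA : Aᵀ = -A) (x e : Λ) (he : e ≠ 0) (c c' : C) :
    (vertex₂ x e A + vertex₁ x e ((1 / 2 : ℝ) • (A * A))) (x + e, c) (x, c') = (1 / 2 : ℝ) * (Aᵀ * A) c c' ∧
      (vertex₂ x e A + vertex₁ x e ((1 / 2 : ℝ) • (A * A))) (x, c) (x + e, c') = (1 / 2 : ℝ) * (Aᵀ * A) c c' := by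
  have hx : x + e ≠ x := fun h => he (add_left_cancel (a := x) (by rw [add_zero]; exact h))
  rw [contact_exp_eq_cross hA]
  simp only [Matrix.smul_apply, Matrix.add_apply, elemIns, Matrix.of_apply, hx, hx.symm, and_self, if_true, if_false, add_zero,
    zero_add, smul_eq_mul]

end Summit.QuantumFields.BalabanUV.Beta.D1BFx.GhostContactExp
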